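import Literature.Topology.FourManifolds.SmoothEmbeddingCriteria
import Literature.Topology.FourManifolds.InverseFunctionTheorem
import Mathlib.Geometry.Manifold.Algebra.LieGroup
import HarnessLib

/-!
# The immersion criterion: injective differential ⇒ immersion (finite-dimensional, no boundary)

Topic `Literature/Topology/FourManifolds`; general infrastructure, listed among the TODOs of
`Mathlib.Geometry.Manifold.Immersion` ("If `f : M → N` is a map between finite-dimensional
manifolds, `mfderiv I J f x` being injective implies `f` is an immersion at `x`").  Mathlib
defines `C^n` immersions (`Manifold.IsImmersionAt`, `Manifold.IsImmersion`) by the existence of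
charts of the maximal atlases in which the map reads `u ↦ equiv (u, 0)`; this file derives that
normal form from the rank condition, for manifolds modelled on boundaryless models over
finite-dimensional real vector spaces:

* `Literature.Topology.FourManifolds.isImmersionAtOfComplement_of_injective_mfderiv` — if `f` is
  `C^n` (`1 ≤ n`) on an open neighbourhood of `x` and `mfderiv I J f x` is injective, then `f` is
  a `C^n` immersion at `x`, with the fixed complement `ℝᵏ = Fin k → ℝ`, `k = dim N - dim M`;
* `Literature.Topology.FourManifolds.isImmersion_of_injective_mfderiv` — a globally `C^n` map with
  everywhere injective differential is a `C^n` immersion;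
* `Literature.Topology.FourManifolds.isSmoothEmbedding_of_injective_of_injective_mfderiv` — an
  injective such map on a compact manifold into a Hausdorff manifold is a `C^n` embedding
  (`Manifold.IsSmoothEmbedding`).

Proof (Lee, *Introduction to Smooth Manifolds* (2013), Thm. 4.12 (rank theorem) in the form of
Prop. 5.22 / Thm. 4.25's local-embedding argument; Hirsch, *Differential Topology* (1976), Ch. 1
§3, Thm. 3.1): let `A = df_x : E → E'` (injective) and `F ⊆ E'` a complement of its range.  In the
extended charts `φ` at `x` and `ψ` at `f x`, the map `Φ : M × F → N`,
`Φ (y, v) = ψ⁻¹ (ψ (f y) + v)`, reads `(u, v) ↦ g u + v` with `g` the chart representative of `f`,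
so its differential at `(x, 0)` is the isomorphism `(u, v) ↦ A u + v : E × F ≅ E'`.  By the inverse
function theorem on manifolds (the tree's
`Literature.Topology.FourManifolds.isLocalDiffeomorphAt_of_hasFDerivAt_writtenInExtChartAt`,
`InverseFunctionTheorem.lean`) `Φ` is a local diffeomorphism at `(x, 0)`, and `f = Φ (·, 0)` near
`x` is the zero section of a product neighbourhood, hence an immersion by the tree's
`Literature.Topology.FourManifolds.isImmersionAtOfComplement_of_eventuallyEq_prod`
(`SmoothEmbeddingCriteria.lean`).  The complement is then transported to the fixed model `ℝᵏ` by a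
dimension count (`Manifold.IsImmersionAtOfComplement.congr_F`), which is what Mathlib's global
notion `Manifold.IsImmersion` (one complement for all points) requires.

Everything here is proved; no named facts are introduced.

## References

* J. M. Lee, *Introduction to Smooth Manifolds*, 2nd ed., GTM 218 (2013), Ch. 4 (Thm. 4.12,
  the rank theorem; immersions, Prop. 4.1 ff.), Ch. 5 (Prop. 5.22). [LeeSmoothManifolds2013]
* M. W. Hirsch, *Differential Topology*, GTM 33 (1976), Ch. 1 §3 (Thm. 3.1: an injective
  immersion of a compact manifold is an embedding). [HirschDT1976]
-/

open scoped Manifold ContDiff Topology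
open Set Function OpenPartialHomeomorph Module

noncomputable section

namespace Literature.Topology.FourManifolds

variable {E H E' H' : Type*} [NormedAddCommGroup E] [NormedSpace ℝ E] [TopologicalSpace H]
  [NormedAddCommGroup E'] [NormedSpace ℝ E'] [TopologicalSpace H']
  {I : ModelWithCorners ℝ E H} {J : ModelWithCorners ℝ E' H'}
  {M : Type*} [TopologicalSpace M] [ChartedSpace H M]
  {N : Type*} [TopologicalSpace N] [ChartedSpace H' N]
  {n : WithTop ℕ∞}

section Algebra

variable [FiniteDimensional ℝ E] [FiniteDimensional ℝ E']

/-- **Linear algebra of the immersion criterion.** For an injective linear map `A : E → E'`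
between finite-dimensional spaces and a complement `F` of its range, `(u, v) ↦ A u + v` is a
continuous linear isomorphism `E × F ≅ E'`. [folklore] -/
theorem exists_continuousLinearEquiv_prod_of_injective (A : E →L[ℝ] E') (hA : Injective A) :
    ∃ (F : Submodule ℝ E') (L : (E × F) ≃L[ℝ] E'),
      (∀ p : E × F, L p = A p.1 + (p.2 : E')) ∧
      finrank ℝ F = finrank ℝ E' - finrank ℝ E := by
  obtain ⟨F, hF⟩ := Submodule.exists_isCompl (LinearMap.range (A : E →ₗ[ℝ] E'))
  have hA' : Injective (A : E →ₗ[ℝ] E') := hA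
  set L₁ : E ≃ₗ[ℝ] LinearMap.range (A : E →ₗ[ℝ] E') := LinearEquiv.ofInjective _ hA'
  set L₂ : (E × F) ≃ₗ[ℝ] (LinearMap.range (A : E →ₗ[ℝ] E') × F) :=
    L₁.prodCongr (LinearEquiv.refl ℝ F)
  set L₃ : (LinearMap.range (A : E →ₗ[ℝ] E') × F) ≃ₗ[ℝ] E' :=
    Submodule.prodEquivOfIsCompl _ _ hF
  set L : (E × F) ≃ₗ[ℝ] E' := L₂.trans L₃ with hL
  refine ⟨F, L.toContinuousLinearEquiv, fun p => ?_, ?_⟩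
  · change L p = A p.1 + (p.2 : E')
    simp only [hL, LinearEquiv.trans_apply]
    change Submodule.prodEquivOfIsCompl _ _ hF (L₁ p.1, p.2) = _
    rw [Submodule.coe_prodEquivOfIsCompl']
    rfl
  · have h1 : finrank ℝ (LinearMap.range (A : E →ₗ[ℝ] E')) + finrank ℝ F = finrank ℝ E' :=
      Submodule.finrank_add_eq_of_isCompl hF
    have h2 : finrank ℝ (LinearMap.range (A : E →ₗ[ℝ] E')) = finrank ℝ E :=
      LinearMap.finrank_range_of_inj hA'
    omega

end Algebra

section Criterion

variable [I.Boundaryless] [J.Boundaryless] [FiniteDimensional ℝ E] [FiniteDimensional ℝ E']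
  [IsManifold I n M] [IsManifold J n N]

/-- **The immersion criterion, with an explicit complement.**  Let `f : M → N` be `C^n`
(`1 ≤ n`) on an open neighbourhood `U` of `x`, between manifolds without boundary modelled on
finite-dimensional real vector spaces, and suppose the differential `mfderiv I J f x` is
injective.  Then, for every complement `F` of the range of the differential presented through an
isomorphism `L (u, v) = A u + v : E × F ≅ E'`, `A = df_x`, `f` is a `C^n` immersion at `x` with complement
`F` (`Manifold.IsImmersionAtOfComplement`).  Proof: the map `Φ (y, v) = ψ⁻¹ (ψ (f y) + v)`
(`ψ` the extended chart at `f x`) has differential `L` at `(x, 0)` in the extended charts, so it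
is a local diffeomorphism there (inverse function theorem on manifolds,
`isLocalDiffeomorphAt_of_hasFDerivAt_writtenInExtChartAt`), and `f` agrees near `x` with its zero
section (`isImmersionAtOfComplement_of_eventuallyEq_prod`).
[cite: LeeSmoothManifolds2013, Ch. 4 Thm. 4.12 and Ch. 5 Prop. 5.22] -/
theorem isImmersionAtOfComplement_of_injective_mfderiv_of_equiv {f : M → N} {x : M} {U : Set M}
    (hU : IsOpen U) (hxU : x ∈ U) (hf : ContMDiffOn I J n f U) (hn : 1 ≤ n)
    (F : Submodule ℝ E') (L : (E × F) ≃L[ℝ] E') (A : E →L[ℝ] E') (hA : A = mfderiv I J f x)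
    (hL : ∀ p : E × F, L p = A p.1 + (p.2 : E')) :
    Manifold.IsImmersionAtOfComplement F I J n f x := by
  haveI : CompleteSpace E := FiniteDimensional.complete ℝ E
  haveI : CompleteSpace (E × ↥F) := FiniteDimensional.complete ℝ (E × ↥F)
  have hn0 : n ≠ 0 := by
    rintro rfl
    exact not_lt.2 hn zero_lt_one
  have hfx : ContMDiffAt I J n f x := hf.contMDiffAt (hU.mem_nhds hxU)
  have hmd : MDifferentiableAt I J f x := hfx.mdifferentiableAt hn0
  -- the open set `W₀ = U ∩ f ⁻¹' (chart source)` around `x`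
  set W₀ : Set M := U ∩ f ⁻¹' (chartAt H' (f x)).source with hW₀
  have hW₀o : IsOpen W₀ := hf.continuousOn.isOpen_inter_preimage hU (chartAt H' (f x)).open_source
  have hxW₀ : x ∈ W₀ := ⟨hxU, mem_chart_source H' (f x)⟩
  have hxW₀' : (extChartAt I x).symm (extChartAt I x x) ∈ W₀ := by
    rw [extChartAt_to_inv]; exact hxW₀
  -- the map `Φ (y, v) = ψ⁻¹ (ψ (f y) + v)`, `ψ` the extended chart at `f x`
  set Φ : M × F → N := fun p =>
    (extChartAt J (f x)).symm (extChartAt J (f x) (f p.1) + (p.2 : E')) with hΦdef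
  -- the inner map `p ↦ ψ (f p.1) + p.2` is `C^n` on `W₀ × F`
  have hinner : ContMDiffOn (I.prod 𝓘(ℝ, F)) 𝓘(ℝ, E') n
      (fun p : M × F => extChartAt J (f x) (f p.1) + (p.2 : E')) (W₀ ×ˢ univ) := by
    have h1 : ContMDiffOn (I.prod 𝓘(ℝ, F)) 𝓘(ℝ, E') n
        (fun p : M × F => extChartAt J (f x) (f p.1)) (W₀ ×ˢ univ) := by
      have hψ' : ContMDiffOn J 𝓘(ℝ, E') n (extChartAt J (f x)) (chartAt H' (f x)).source :=
        contMDiffOn_extChartAt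
      have hf' : ContMDiffOn (I.prod 𝓘(ℝ, F)) J n (fun p : M × F => f p.1) (W₀ ×ˢ univ) :=
        hf.comp contMDiffOn_fst fun p hp => hp.1.1
      exact hψ'.comp hf' fun p hp => hp.1.2
    have h2 : ContMDiff (I.prod 𝓘(ℝ, F)) 𝓘(ℝ, E') n (fun p : M × F => ((p.2 : F) : E')) := by
      have : ContMDiff 𝓘(ℝ, F) 𝓘(ℝ, E') n (fun v : F => (v : E')) :=
        (Submodule.subtypeL F).contMDiff
      exact this.comp contMDiff_snd
    exact h1.add h2.contMDiffOn
  -- the open set `W` around `(x, 0)` on which `Φ` is `C^n`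
  set W : Set (M × F) := (W₀ ×ˢ univ) ∩
      (fun p : M × F => extChartAt J (f x) (f p.1) + (p.2 : E')) ⁻¹' (extChartAt J (f x)).target
    with hW
  have hWo : IsOpen W :=
    hinner.continuousOn.isOpen_inter_preimage (hW₀o.prod isOpen_univ) (isOpen_extChartAt_target _)
  have hx0W : ((x, (0 : F)) : M × F) ∈ W := by
    refine ⟨⟨hxW₀, mem_univ _⟩, ?_⟩
    simp only [mem_preimage, ZeroMemClass.coe_zero, add_zero]
    exact mem_extChartAt_target (f x)
  have hΦ : ContMDiffOn (I.prod 𝓘(ℝ, F)) J n Φ W := by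
    have hsymm : ContMDiffOn 𝓘(ℝ, E') J n (extChartAt J (f x)).symm (extChartAt J (f x)).target :=
      contMDiffOn_extChartAt_symm (f x)
    exact hsymm.comp (hinner.mono inter_subset_left) fun p hp => hp.2
  -- `Φ (x, 0) = f x`
  have hΦx : Φ (x, 0) = f x := by
    simp only [hΦdef, ZeroMemClass.coe_zero, add_zero]
    exact (extChartAt J (f x)).left_inv (mem_extChartAt_source (f x))
  -- the chart representative `g` of `f` and its derivative
  set g : E → E' := writtenInExtChartAt I J x f with hg
  have hgd : HasFDerivAt g A (extChartAt I x x) := by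
    have hd : DifferentiableWithinAt ℝ g (range I) (extChartAt I x x) :=
      hmd.differentiableWithinAt_writtenInExtChartAt
    rw [I.range_eq_univ, differentiableWithinAt_univ] at hd
    have := hd.hasFDerivAt
    rwa [← fderivWithin_univ, ← I.range_eq_univ, ← hmd.mfderiv, ← hA] at this
  -- the extended chart of `M × F` at `(x, 0)`
  have hchart : extChartAt (I.prod 𝓘(ℝ, F)) ((x, (0 : F)) : M × F) =
      (extChartAt I x).prod (PartialEquiv.refl F) := by
    rw [extChartAt_prod, extChartAt_model_space_eq_id]
  -- continuity of `q ↦ φ⁻¹ q.1` at `(φ x, 0)`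
  have hc : ContinuousAt (fun q : E × F => (extChartAt I x).symm q.1) (extChartAt I x x, (0 : F)) :=
    ContinuousAt.comp_of_eq (continuousAt_extChartAt_symm x) continuousAt_fst rfl
  -- the written-in-charts expression of `Φ` agrees with `(u, v) ↦ g u + v` near `(φ x, 0)`
  have hev : writtenInExtChartAt (I.prod 𝓘(ℝ, F)) J ((x, (0 : F)) : M × F) Φ
      =ᶠ[𝓝 (extChartAt I x x, (0 : F))] fun q : E × F => g q.1 + (q.2 : E') := by
    have h2 : ∀ᶠ q : E × F in 𝓝 (extChartAt I x x, (0 : F)), (extChartAt I x).symm q.1 ∈ W₀ :=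
      hc.preimage_mem_nhds (hW₀o.mem_nhds hxW₀')
    have h3 : ∀ᶠ q : E × F in 𝓝 (extChartAt I x x, (0 : F)),
        extChartAt J (f x) (f ((extChartAt I x).symm q.1)) + (q.2 : E') ∈
          (extChartAt J (f x)).target := by
      have hmap : ContinuousAt (fun q : E × F => (((extChartAt I x).symm q.1, q.2) : M × F))
          (extChartAt I x x, (0 : F)) := hc.prodMk continuousAt_snd
      have hmem : (((extChartAt I x).symm (extChartAt I x x), (0 : F)) : M × F) ∈
          W₀ ×ˢ (univ : Set F) := ⟨hxW₀', mem_univ _⟩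
      have hc' : ContinuousAt
          (fun q : E × F => extChartAt J (f x) (f ((extChartAt I x).symm q.1)) + (q.2 : E'))
          (extChartAt I x x, (0 : F)) :=
        ContinuousAt.comp_of_eq
          (hinner.continuousOn.continuousAt ((hW₀o.prod isOpen_univ).mem_nhds hmem)) hmap rfl
      refine hc'.preimage_mem_nhds ((isOpen_extChartAt_target (f x)).mem_nhds ?_)
      rw [extChartAt_to_inv]
      simp only [ZeroMemClass.coe_zero, add_zero]
      exact mem_extChartAt_target (f x)
    filter_upwards [h2, h3] with q hq2 hq3
    change (extChartAt J (Φ (x, 0)) ∘ Φ ∘ (extChartAt (I.prod 𝓘(ℝ, F)) (x, (0 : F))).symm) q =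
      g q.1 + (q.2 : E')
    rw [hΦx, hchart]
    simp only [Function.comp_apply, PartialEquiv.prod_symm, PartialEquiv.refl_symm,
      PartialEquiv.prod_coe, PartialEquiv.refl_coe, id_eq]
    simp only [hΦdef, hg, writtenInExtChartAt, Function.comp_apply]
    rw [(extChartAt J (f x)).right_inv hq3]
  have hderiv : HasFDerivAt (writtenInExtChartAt (I.prod 𝓘(ℝ, F)) J ((x, (0 : F)) : M × F) Φ)
      (L : E × F →L[ℝ] E') (extChartAt (I.prod 𝓘(ℝ, F)) ((x, (0 : F)) : M × F) (x, 0)) := by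
    have hpt : extChartAt (I.prod 𝓘(ℝ, F)) ((x, (0 : F)) : M × F) (x, 0) =
        (extChartAt I x x, (0 : F)) := by
      rw [hchart]
      rfl
    rw [hpt]
    have h1 : HasFDerivAt (fun q : E × F => g q.1 + (q.2 : E'))
        (A.comp (ContinuousLinearMap.fst ℝ E F) +
          (Submodule.subtypeL F).comp (ContinuousLinearMap.snd ℝ E F))
        (extChartAt I x x, (0 : F)) := by
      have ha : HasFDerivAt (g ∘ Prod.fst) (A.comp (ContinuousLinearMap.fst ℝ E F))
          ((extChartAt I x x, (0 : F)) : E × F) :=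
        HasFDerivAt.comp ((extChartAt I x x, (0 : F)) : E × F) (by exact hgd) hasFDerivAt_fst
      have hb : HasFDerivAt ((Submodule.subtypeL F : F → E') ∘ Prod.snd)
          ((Submodule.subtypeL F).comp (ContinuousLinearMap.snd ℝ E F))
          ((extChartAt I x x, (0 : F)) : E × F) :=
        HasFDerivAt.comp ((extChartAt I x x, (0 : F)) : E × F)
          (Submodule.subtypeL F).hasFDerivAt hasFDerivAt_snd
      exact ha.add hb
    have hLeq : (L : E × F →L[ℝ] E') =
        A.comp (ContinuousLinearMap.fst ℝ E F) +
          (Submodule.subtypeL F).comp (ContinuousLinearMap.snd ℝ E F) := by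
      refine ContinuousLinearMap.ext fun q => ?_
      rw [ContinuousLinearEquiv.coe_coe, hL q]
      rfl
    rw [hLeq]
    exact h1.congr_of_eventuallyEq hev
  -- the inverse function theorem
  have hloc : IsLocalDiffeomorphAt (I.prod 𝓘(ℝ, F)) J n Φ (x, 0) :=
    isLocalDiffeomorphAt_of_hasFDerivAt_writtenInExtChartAt hWo hx0W hΦ hn L hderiv
  obtain ⟨Θ, hxΘ, heqΘ⟩ := hloc
  -- `f` is the zero section of the product neighbourhood `Θ`
  have hfev : f =ᶠ[𝓝 x] fun y => Θ.toOpenPartialHomeomorph (y, 0) := by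
    have h1 : ∀ᶠ y in 𝓝 x, ((y, (0 : F)) : M × F) ∈ Θ.source :=
      (Continuous.prodMk_left (0 : F)).continuousAt.preimage_mem_nhds
        (Θ.open_source.mem_nhds hxΘ)
    have h2 : ∀ᶠ y in 𝓝 x, y ∈ W₀ := hW₀o.mem_nhds hxW₀
    filter_upwards [h1, h2] with y hy1 hy2
    change f y = Θ (y, 0)
    rw [← heqΘ hy1]
    simp only [hΦdef, ZeroMemClass.coe_zero, add_zero]
    have hy : f y ∈ (extChartAt J (f x)).source := by
      rw [extChartAt_source]; exact hy2.2
    exact ((extChartAt J (f x)).left_inv hy).symm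
  exact isImmersionAtOfComplement_of_eventuallyEq_prod Θ.toOpenPartialHomeomorph
    Θ.contMDiffOn_toFun Θ.contMDiffOn_invFun L hxΘ hfev

/-- **The immersion criterion** (Lee (2013), Ch. 4; Mathlib TODO of
`Mathlib.Geometry.Manifold.Immersion`): a map between manifolds without boundary modelled on
finite-dimensional real vector spaces which is `C^n` (`1 ≤ n`) on an open neighbourhood of `x`
and has injective differential at `x` is a `C^n` immersion at `x`, with complement the fixed
model `ℝᵏ`, `k = dim E' - dim E` (so that the complement does not depend on the point, as
Mathlib's `Manifold.IsImmersion` requires).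
[cite: LeeSmoothManifolds2013, Ch. 4 Thm. 4.12 and Ch. 5 Prop. 5.22] -/
theorem isImmersionAtOfComplement_of_injective_mfderiv {f : M → N} {x : M} {U : Set M}
    (hU : IsOpen U) (hxU : x ∈ U) (hf : ContMDiffOn I J n f U) (hn : 1 ≤ n)
    (hinj : Injective (mfderiv I J f x)) :
    Manifold.IsImmersionAtOfComplement (Fin (finrank ℝ E' - finrank ℝ E) → ℝ) I J n f x := by
  obtain ⟨F, L, hL, hdim⟩ :=
    exists_continuousLinearEquiv_prod_of_injective (E := E) (E' := E')
      (mfderiv I J f x : E →L[ℝ] E') hinj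
  have h := isImmersionAtOfComplement_of_injective_mfderiv_of_equiv hU hxU hf hn F L _ rfl hL
  have hdim' : finrank ℝ F = finrank ℝ (Fin (finrank ℝ E' - finrank ℝ E) → ℝ) := by
    rw [Module.finrank_fin_fun, hdim]
  exact (Manifold.IsImmersionAtOfComplement.congr_F (ContinuousLinearEquiv.ofFinrankEq hdim')).1 h

/-- **The immersion criterion, pointwise form** (`Manifold.IsImmersionAt`).
[cite: LeeSmoothManifolds2013, Ch. 4 Thm. 4.12 and Ch. 5 Prop. 5.22] -/
theorem isImmersionAt_of_injective_mfderiv {f : M → N} {x : M} {U : Set M}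
    (hU : IsOpen U) (hxU : x ∈ U) (hf : ContMDiffOn I J n f U) (hn : 1 ≤ n)
    (hinj : Injective (mfderiv I J f x)) : Manifold.IsImmersionAt I J n f x :=
  (isImmersionAtOfComplement_of_injective_mfderiv hU hxU hf hn hinj).isImmersionAt

/-- **A `C^n` map with everywhere injective differential is a `C^n` immersion with the one
complement `ℝᵏ` for all points** (`Manifold.IsImmersionOfComplement`), for manifolds without
boundary modelled on finite-dimensional real vector spaces.
[cite: LeeSmoothManifolds2013, Ch. 4 Thm. 4.12 and Ch. 5 Prop. 5.22] -/
theorem isImmersionOfComplement_of_injective_mfderiv {f : M → N} (hf : ContMDiff I J n f)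
    (hn : 1 ≤ n) (hinj : ∀ x, Injective (mfderiv I J f x)) :
    Manifold.IsImmersionOfComplement (Fin (finrank ℝ E' - finrank ℝ E) → ℝ) I J n f := fun x =>
  isImmersionAtOfComplement_of_injective_mfderiv isOpen_univ (mem_univ x) hf.contMDiffOn hn (hinj x)

/-- **A `C^n` map with everywhere injective differential is a `C^n` immersion**
(`Manifold.IsImmersion`), for manifolds without boundary modelled on finite-dimensional real
vector spaces. [cite: LeeSmoothManifolds2013, Ch. 4 Thm. 4.12 and Ch. 5 Prop. 5.22] -/
theorem isImmersion_of_injective_mfderiv {f : M → N} (hf : ContMDiff I J n f) (hn : 1 ≤ n)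
    (hinj : ∀ x, Injective (mfderiv I J f x)) : Manifold.IsImmersion I J n f :=
  (isImmersionOfComplement_of_injective_mfderiv hf hn hinj).isImmersion

/-- **An injective immersion of a compact manifold is an embedding** (Hirsch (1976), Ch. 1 §3,
Thm. 3.1), in Mathlib's chart sense `Manifold.IsSmoothEmbedding`: a `C^n` (`1 ≤ n`) injective map
with everywhere injective differential from a compact manifold to a Hausdorff manifold, both
without boundary and modelled on finite-dimensional real vector spaces, is a `C^n` embedding.
[cite: HirschDT1976, Ch. 1 §3 Thm. 3.1] -/
theorem isSmoothEmbedding_of_injective_of_injective_mfderiv [CompactSpace M] [T2Space N]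
    {f : M → N} (hf : ContMDiff I J n f) (hn : 1 ≤ n) (hinj : Injective f)
    (hd : ∀ x, Injective (mfderiv I J f x)) : Manifold.IsSmoothEmbedding I J n f :=
  ⟨isImmersion_of_injective_mfderiv hf hn hd, (hf.continuous.isClosedEmbedding hinj).isEmbedding⟩

end Criterion

end Literature.Topology.FourManifolds
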